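import Summits.KontsevichZagierPeriods.KontsevichZagierPeriods.Theorems.LinRedNormalFormArrangementNormalFormStubRebaseSimpleZeroTwoDifferent

/-!
# Stub `stub_rebaseSimpleZeroTwo`, assembly (crux `ArrangementNormalForm`, line `janus-bands`) — part `TwoTarget`

The conditional closures of `stub_rebaseSimpleZeroTwo` for an ARBITRARY target of the
different-slope hypothesis `HDiff` (worker W8), so that whichever literal target class W8 lands
(the rebased class `GG 0 2 2`, or a wider literal class inside `GG 0 2 2 ∪ JJ 0 3 ∪ JD 2`) plugs in
without restating the pattern normalisation:
* `rebaseSimpleZeroTwo_of_differentS` (registered, literal binders): for any `S ⊇ GG 0 2 2`, if the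
  clean nests with letters of different `y`-slopes are `S`-good then every literal `GS 0 2` datum is
  `S`-good (`rebaseSimpleZeroTwo_of_clean` + `RebaseNest.clean_of_diff`);
* `rebaseSimpleZeroTwo_of_differentIn'` (stub format): for any `T ⊆ GG 0 2 2 ∪ JJ 0 3 ∪ JD 2`, if the
  clean nests with letters of different `y`-slopes are `T`-good then the stub holds (run the
  reduction with the target `T ∪ GG 0 2 2`).

References: M. Kontsevich, D. Zagier, *Periods* (2001), §1.2, rules (1a), (1b), (2).
-/

noncomputable section

open Set MeasureTheory MvPolynomial
open Literature.NumberTheory.Transcendental Literature.ModelTheory.ExponentialFields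

namespace Summit.KontsevichZagierPeriods.ArrangementNormalForm.JanusBands

/-- **The two-fibre rebase into an arbitrary target `S ⊇ GG 0 2 2`, conditionally on the
different-slope hypothesis with target `S`** (registered part of `stub_rebaseSimpleZeroTwo`, line
`janus-bands`, literal binders). A representation with a literal `GS 0 2` datum (`n₂ = 1`, hence
`n₁ = 0`) is congruent modulo `KZ.relations` to a `ℤ`-combination of elements of `S`, PROVIDED so is
every clean nest `A(y) < tᵢ < tⱼ < B(y)` both of whose fibres carry letters of DIFFERENT `y`-slopes
(`HDiff` with target `S`): `rebaseSimpleZeroTwo_of_clean` (product fibres, pattern normalisation)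
with the clean-nest hypothesis `RebaseNest.clean_of_diff` (common slope: the landed
`rebaseSimpleZero_nestedCommonMain`, good for `GG 0 2 2 ⊆ S`; different slopes: `HDiff`).
[Kontsevich–Zagier 2001, §1.2, rules (1a), (1b), (2)] -/
theorem rebaseSimpleZeroTwo_of_differentS (S : Set KZ.FormalRep) (hS : SeparatePos.GGset 0 2 2 ⊆ S) (HDiff : ∀ (m m' : ℕ) (s : KZ.IntegralRep (0 + 1 + 2)) (M : Fin m' → (Fin (0 + 1) → ℚ) × ℚ) (L : Fin m → (Fin 0 → ℚ) × ℚ) (e : Fin m → ℕ) (p : MvPolynomial (Fin 0) ℚ) (ℓ₁ ℓ₂ : (Fin 0 → ℚ) × ℚ) (a : Fin 2 → Option ((Fin (0 + 1) → ℚ) × ℚ)) (lo hi : Fin 2 → Fin 2 ⊕ ((Fin (0 + 1) → ℚ) × ℚ)) (i j : Fin 2) (A B ci cj : (Fin (0 + 1) → ℚ) × ℚ), i ≠ j → lo i = Sum.inr A → hi i = Sum.inl j → lo j = Sum.inl i → hi j = Sum.inr B → a i = some ci → a j = some cj → ci.1 (Fin.last 0) ≠ cj.1 (Fin.last 0) →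 Bornology.IsBounded s.domain → s.domain = SeparatePos.gDom 0 2 m' M lo hi → EqOn s.integrand (RebasePos.glit 0 2 p L e ℓ₁ ℓ₂ 0 1 a) s.domain → ∃ c ∈ AddSubgroup.closure S, KZ.of s - c ∈ KZ.relations) (m m' n₁ n₂ : ℕ) (s : KZ.IntegralRep (0 + 1 + 2)) (M : Fin m' → (Fin (0 + 1) → ℚ) × ℚ) (L : Fin m → (Fin 0 → ℚ) × ℚ) (e : Fin m → ℕ) (p : MvPolynomial (Fin 0) ℚ) (ℓ₁ ℓ₂ : (Fin 0 → ℚ) × ℚ) (a : Fin 2 → Option ((Fin (0 + 1) → ℚ) × ℚ)) (lo hi : Fin 2 → Fin 2 ⊕ ((Fin (0 + 1) → ℚ) × ℚ)) (h12 : n₁ = 0 ∨ n₂ = 0) (hn : n₂ = 1) (hbd : Bornology.IsBounded s.domain) (hdom : s.domain = SeparatePos.gDom 0 2 m' M lo hi) (hint : EqOn s.integrand (RebasePos.glit 0 2 p L e ℓ₁ ℓ₂ n₁ n₂ a) s.domain) : ∃ c ∈ AddSubgroup.closure S, KZ.of s - c ∈ KZ.relations := by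
  subst hn
  obtain rfl : n₁ = 0 := h12.resolve_right one_ne_zero
  exact rebaseSimpleZeroTwo_of_clean S hS (RebaseNest.clean_of_diff hS HDiff) m m' s M L e p ℓ₁ ℓ₂ a lo hi hbd hdom hint

/-- **`stub_rebaseSimpleZeroTwo` conditionally on the different-slope hypothesis with an ARBITRARY
target `T ⊆ GG 0 2 2 ∪ JJ 0 3 ∪ JD 2`** (line `janus-bands`). Elements of `GS 0 2` are congruent
modulo `KZ.relations` to `ℤ`-combinations of elements of `GG 0 2 2 ∪ JJ 0 3 ∪ JD 2`, PROVIDED every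
clean nest `A(y) < tᵢ < tⱼ < B(y)` both of whose fibres carry letters of DIFFERENT `y`-slopes is
congruent to a `ℤ`-combination of elements of `T` (`HDiff` with target `T`, worker W8; `T` is any
set with `T ⊆ GG 0 2 2 ∪ JJ 0 3 ∪ JD 2`, e.g. a literal copy of `GG 0 2 2` or of a wider part of the
stub's target). Proof: `rebaseSimpleZeroTwo_of_differentS` with the target `T ∪ GG 0 2 2`, then
`T ∪ GG 0 2 2 ⊆ GG 0 2 2 ∪ JJ 0 3 ∪ JD 2` (`hT`, `hGG`). The defining equations of `JJ`, `JD` are not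
needed. [Kontsevich–Zagier 2001, §1.2, rules (1a), (1b), (2)] -/
theorem rebaseSimpleZeroTwo_of_differentIn' (GS : ℕ → ℕ → Set KZ.FormalRep) (GG : ℕ → ℕ → ℕ → Set KZ.FormalRep) (hGS : ∀ b k, GS b k = {w : KZ.FormalRep | ∃ (m m' n₁ n₂ : ℕ) (s : KZ.IntegralRep (b + 1 + k)) (M : Fin m' → (Fin (b + 1) → ℚ) × ℚ) (L : Fin m → (Fin b → ℚ) × ℚ) (e : Fin m → ℕ) (p : MvPolynomial (Fin b) ℚ) (ℓ₁ ℓ₂ : (Fin b → ℚ) × ℚ) (a : Fin k → Option ((Fin (b + 1) → ℚ) × ℚ)) (lo hi : Fin k → Fin k ⊕ ((Fin (b + 1) → ℚ) × ℚ)), (n₁ = 0 ∨ n₂ = 0) ∧ n₂ = 1 ∧ Bornology.IsBounded s.domain ∧ s.domain = {z | (∀ j, 0 < ∑ i, ((M j).1 i : ℝ) * z (Fin.castAdd k i) + ((M j).2 : ℝ)) ∧ ∀ i, Sum.elim (fun j => z (Fin.natAdd (b + 1) j)) (fun c => ∑ i', (c.1 i' : ℝ) * z (Fin.castAdd k i')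 + (c.2 : ℝ)) (lo i) < z (Fin.natAdd (b + 1) i) ∧ z (Fin.natAdd (b + 1) i) < Sum.elim (fun j => z (Fin.natAdd (b + 1) j)) (fun c => ∑ i', (c.1 i' : ℝ) * z (Fin.castAdd k i') + (c.2 : ℝ)) (hi i)} ∧ EqOn s.integrand (fun z => MvPolynomial.aeval (fun i => z (Fin.castAdd k (Fin.castSucc i))) p / (∏ j, (∑ i, ((L j).1 i : ℝ) * z (Fin.castAdd k (Fin.castSucc i)) + ((L j).2 : ℝ)) ^ e j) * ((z (Fin.castAdd k (Fin.last b)) - (∑ i, (ℓ₁.1 i : ℝ) * z (Fin.castAdd k (Fin.castSucc i)) + (ℓ₁.2 : ℝ))) ^ n₁ / (z (Fin.castAdd k (Fin.last b)) - (∑ i, (ℓ₂.1 i : ℝ) * z (Fin.castAdd k (Fin.castSucc i)) + (ℓ₂.2 : ℝ))) ^ n₂) * ∏ i, (a i).elim 1 (fun c => 1 / (z (Fin.natAdd (b + 1) i) - (∑ i', (c.1 i' : ℝ) * z (Fin.castAdd k i') + (c.2 : ℝ))))) s.domain ∧ w = KZ.of s}) (hGG : ∀ b σ k, GG b σ k =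 {w : KZ.FormalRep | ∃ (m m' n₁ n₂ : ℕ) (s : KZ.IntegralRep (b + 1 + k)) (M : Fin m' → (Fin (b + 1) → ℚ) × ℚ) (L : Fin m → (Fin b → ℚ) × ℚ) (e : Fin m → ℕ) (p : MvPolynomial (Fin b) ℚ) (ℓ₁ ℓ₂ : (Fin b → ℚ) × ℚ) (a : Fin k → Option ((Fin (b + 1) → ℚ) × ℚ)) (lo hi : Fin k → Fin k ⊕ ((Fin (b + 1) → ℚ) × ℚ)), (n₁ = 0 ∨ n₂ = 0) ∧ (σ = 2 → (∀ i c, a i = some c → c.1 (Fin.last b) = 0) ∧ (∀ i c, (lo i = Sum.inr c ∨ hi i = Sum.inr c) → (c.1 (Fin.last b) = 0 ∨ c = (Pi.single (Fin.last b) 1, 0)))) ∧ Bornology.IsBounded s.domain ∧ s.domain = {z | (∀ j, 0 < ∑ i, ((M j).1 i : ℝ) * z (Fin.castAdd k i) + ((M j).2 : ℝ)) ∧ ∀ i, Sum.elim (fun j => z (Fin.natAdd (b + 1) j)) (fun c => ∑ i', (c.1 i' : ℝ) * z (Fin.castAdd k i') + (c.2 : ℝ)) (lo i) < z (Fin.natAdd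 (b + 1) i) ∧ z (Fin.natAdd (b + 1) i) < Sum.elim (fun j => z (Fin.natAdd (b + 1) j)) (fun c => ∑ i', (c.1 i' : ℝ) * z (Fin.castAdd k i') + (c.2 : ℝ)) (hi i)} ∧ EqOn s.integrand (fun z => MvPolynomial.aeval (fun i => z (Fin.castAdd k (Fin.castSucc i))) p / (∏ j, (∑ i, ((L j).1 i : ℝ) * z (Fin.castAdd k (Fin.castSucc i)) + ((L j).2 : ℝ)) ^ e j) * ((z (Fin.castAdd k (Fin.last b)) - (∑ i, (ℓ₁.1 i : ℝ) * z (Fin.castAdd k (Fin.castSucc i)) + (ℓ₁.2 : ℝ))) ^ n₁ / (z (Fin.castAdd k (Fin.last b)) - (∑ i, (ℓ₂.1 i : ℝ) * z (Fin.castAdd k (Fin.castSucc i)) + (ℓ₂.2 : ℝ))) ^ n₂) * ∏ i, (a i).elim 1 (fun c => 1 / (z (Fin.natAdd (b + 1) i) - (∑ i', (c.1 i' : ℝ) * z (Fin.castAdd k i') + (c.2 : ℝ))))) s.domain ∧ w = KZ.of s}) (JJ : ℕ → ℕ → Set KZ.FormalRep) (JD : ℕ → Set KZ.FormalRep) (hJJ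 : ∀ b k, JJ b k = {w : KZ.FormalRep | ∃ (m m' : ℕ) (s : KZ.IntegralRep (b + k)) (M : Fin m' → (Fin b → ℚ) × ℚ) (L : Fin m → (Fin b → ℚ) × ℚ) (e : Fin m → ℕ) (p : MvPolynomial (Fin b) ℚ) (a : Fin k → Option ((Fin b → ℚ) × ℚ)) (lo hi : Fin k → Fin k ⊕ ((Fin b → ℚ) × ℚ)), Bornology.IsBounded s.domain ∧ s.domain = {z | (∀ j, 0 < ∑ i, ((M j).1 i : ℝ) * z (Fin.castAdd k i) + ((M j).2 : ℝ)) ∧ ∀ i, Sum.elim (fun j => z (Fin.natAdd b j)) (fun c => ∑ i', (c.1 i' : ℝ) * z (Fin.castAdd k i') + (c.2 : ℝ)) (lo i) < z (Fin.natAdd b i) ∧ z (Fin.natAdd b i) < Sum.elim (fun j => z (Fin.natAdd b j)) (fun c => ∑ i', (c.1 i' : ℝ) * z (Fin.castAdd k i') + (c.2 : ℝ)) (hi i)} ∧ EqOn s.integrand (fun z => MvPolynomial.aeval (fun i => z (Fin.castAdd k i)) p / (∏ j, (∑ i, ((L j).1 i : ℝ) * z (Fin.castAdd k i) + ((L j).2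 : ℝ)) ^ e j) * ∏ i, (a i).elim 1 (fun c => 1 / (z (Fin.natAdd b i) - (∑ i', (c.1 i' : ℝ) * z (Fin.castAdd k i') + (c.2 : ℝ))))) s.domain ∧ w = KZ.of s}) (hJD : ∀ N, JD N = {w : KZ.FormalRep | ∃ b' k', b' + k' = N ∧ w ∈ JJ b' k'}) (T : Set KZ.FormalRep) (hT : T ⊆ GG 0 2 2 ∪ JJ 0 3 ∪ JD 2) (HDiff : ∀ (m m' : ℕ) (s : KZ.IntegralRep (0 + 1 + 2)) (M : Fin m' → (Fin (0 + 1) → ℚ) × ℚ) (L : Fin m → (Fin 0 → ℚ) × ℚ) (e : Fin m → ℕ) (p : MvPolynomial (Fin 0) ℚ) (ℓ₁ ℓ₂ : (Fin 0 → ℚ) × ℚ) (a : Fin 2 → Option ((Fin (0 + 1) → ℚ) × ℚ)) (lo hi : Fin 2 → Fin 2 ⊕ ((Fin (0 + 1) → ℚ) × ℚ)) (i j : Fin 2) (A B ci cj : (Fin (0 + 1) → ℚ) × ℚ), i ≠ j → lo i = Sum.inr A → hi i = Sum.inl j → lo j = Sum.inl i → hi j = Sum.inr B → a i = some ci → a j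 = some cj → ci.1 (Fin.last 0) ≠ cj.1 (Fin.last 0) → Bornology.IsBounded s.domain → s.domain = SeparatePos.gDom 0 2 m' M lo hi → EqOn s.integrand (RebasePos.glit 0 2 p L e ℓ₁ ℓ₂ 0 1 a) s.domain → ∃ c ∈ AddSubgroup.closure T, KZ.of s - c ∈ KZ.relations) : ∀ x ∈ GS 0 2, ∃ c ∈ AddSubgroup.closure (GG 0 2 2 ∪ JJ 0 3 ∪ JD 2), x - c ∈ KZ.relations := by
  -- the defining equations of `JJ` and `JD` are part of the stub format but not needed here
  have _ := hJJ
  have _ := hJD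
  intro x hx
  rw [hGS] at hx
  obtain ⟨m, m', n₁, n₂, s, M, L, e, p, ℓ₁, ℓ₂, a, lo, hi, h12, hn, hbd, hdom, hint, rfl⟩ := hx
  have hGGs : SeparatePos.GGset 0 2 2 ⊆ T ∪ SeparatePos.GGset 0 2 2 := subset_union_right
  have hsub : T ∪ SeparatePos.GGset 0 2 2 ⊆ GG 0 2 2 ∪ JJ 0 3 ∪ JD 2 :=
    union_subset hT fun w hw => Or.inl (Or.inl (by rw [hGG]; exact hw))
  obtain ⟨c, hc, hxc⟩ := rebaseSimpleZeroTwo_of_differentS (T ∪ SeparatePos.GGset 0 2 2) hGGs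
    (fun m m' s M L e p ℓ₁ ℓ₂ a lo hi i j A B ci cj hij hloi hhii hloj hhij hai haj hne hbd hdom hint => by
      obtain ⟨c, hc, hxc⟩ := HDiff m m' s M L e p ℓ₁ ℓ₂ a lo hi i j A B ci cj hij hloi hhii hloj hhij hai haj hne hbd
        hdom hint
      exact ⟨c, AddSubgroup.closure_mono subset_union_left hc, hxc⟩)
    m m' n₁ n₂ s M L e p ℓ₁ ℓ₂ a lo hi h12 hn hbd hdom hint
  exact ⟨c, AddSubgroup.closure_mono hsub hc, hxc⟩

end Summit.KontsevichZagierPeriods.ArrangementNormalForm.JanusBands
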